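import Literature.NumberTheory.EllipticCurves.FunctionFieldEllipticLFormalLeavesProofs
import Literature.NumberTheory.EllipticCurves.FunctionFieldEllipticLConstantNoRHProofs
import Literature.NumberTheory.DiophantineGeometry.FunctionFieldSchmidtDegreeOneConsequencesProofs
import Literature.NumberTheory.DiophantineGeometry.FunctionFieldZetaLPolynomialProofs
import Literature.NumberTheory.DiophantineGeometry.FunctionFieldHasseWeilProofs
import HarnessLib

/-!
# Grothendieck rationality of `L(E, T)`: the constant case unconditionally, from F. K. Schmidt's theorem

Second sibling **proof file** (theorems only, sorry-free; D-0014 / D-0026) of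
`Literature.NumberTheory.EllipticCurves.FunctionFieldEllipticLFormal`, written in the provefact pass
on its named fact `isRational_formalL Fq W` (Ulmer 2011, Lecture 1, §9, Exercise 9.2 and
Theorem 9.3: for an elliptic curve `E` over a global function field `F ⊇ 𝔽_q(t)`, the formal Euler
product `L(E, T) ∈ ℤ[[T]]` of (9.1) is `P/Q` with `P, Q ∈ ℤ[T]`, `Q(0) = 1`, the complex roots of `Q`
on `|T| = q^{-1/2}` or `|T| = q^{-3/2}`), continuing `FunctionFieldEllipticLFormalLeavesProofs`.

## What changed, and what is proved here

`FunctionFieldEllipticLFormalLeavesProofs` reduced the fact to two leaves over the finite constant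
fields `k` of `F`: Ulmer's Theorem 9.3 (`ellLFunction_eq_prod_of_not_isConstantCurve k W`,
Grothendieck–Deligne) for non-constant `E`, and — for **constant** `E ≅ E₀ ×_k F` — Weil's theorem
for `F/k` in the form `IsGenus k F g` (`2g` numbers `βⱼ` with `N_n = qⁿ + 1 - ∑ βⱼⁿ` **and** the
Riemann hypothesis `|βⱼ| = √q`), itself reduced to F. K. Schmidt's `∂ = 1` and the Hasse–Weil
theorem (Stichtenoth Cor. 5.1.11, Thm. 5.2.1). Since then F. K. Schmidt's theorem has been
**proved** in the tree (`minPosDegree_eq_one_holds`, hence Stichtenoth Thm. 5.1.15 (a),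
`lSeries_eq_polynomial_holds`: `L_F(t) = (1 - t)(1 - qt) Z_F(t) ∈ ℤ[t]`, `deg L_F = 2g`), and
`FunctionFieldEllipticLConstantNoRHProofs` re-ran Exercise 9.2 under an *RH-free Weil form* of
`ζ_F` — any finite family `β` with `N_n = qⁿ + 1 - ∑ βⱼⁿ` (`n ≥ 1`) and `|βⱼ| ≤ q` — noting that
such a family "is provided by F. K. Schmidt's rationality theorem together with the absolute
convergence of the Euler product on `|u| < q⁻¹` (no zero of `L` there, so `|βⱼ| ≤ q`)". This file
supplies that family and draws the consequences:

* `norm_le_card_of_weilCount_eq` — **the trivial bound `|βⱼ| ≤ q`, proved.** For a global function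
  field `F / 𝔽_q(t)` and *any* finite family `β` of complex numbers with `N_n = qⁿ + 1 - ∑ⱼ βⱼⁿ`
  for all `n ≥ 1` (`N_n = weilCount Fq F n`), every `βⱼ` has `|βⱼ| ≤ q`. This is the content of
  Stichtenoth Prop. 5.1.8 ("In particular `Z(t) ≠ 0` for `|t| < q⁻¹`", so `L(t) = ∏ (1 - αᵢt)` has
  no zero there) proved by the convergence-radius argument of Stichtenoth §5.2, (5.22) (there with
  `q^{-1/2}` under the estimate (5.21); here with `q⁻¹` under no estimate at all): the Euler product
  over the places of `F` gives `∑ₙ N_n ρⁿ/n < ∞` for `0 ≤ ρ < q⁻¹` (`summable_weilCount_mul_pow_div`,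
  from the tree's `summable_residueCard_rpow_neg` through `summable_pow_degree` and
  `hasSum_regroup_dvd`), hence the power sums `pₙ = ∑ⱼ βⱼⁿ = qⁿ + 1 - N_n` make
  `G(z) = ∑ₙ pₙ zⁿ/n` holomorphic on `|z| < q⁻¹`; near `0`, `exp(-G(z)) = ∏ⱼ (1 - βⱼ z)`
  (`-log(1 - w) = ∑ wⁿ/n`), so by the identity theorem the polynomial `∏ⱼ (1 - βⱼ z)` equals the
  non-vanishing function `exp(-G)` on the whole disc and cannot have the zero `z = 1/βⱼ` with
  `|1/βⱼ| < q⁻¹`.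
* `exists_weilCount_eq_of_isIntegrallyClosedIn`, `exists_weilCount_eq_of_isFullConstantField` —
  **the RH-free Weil form of `ζ_F`, proved**: if `𝔽_q` is the full constant field of `F` there are
  `β₁, …, β_{2g} ∈ ℂ` (`g` the Riemann–Roch genus), all nonzero, with `N_n = qⁿ + 1 - ∑ βⱼⁿ` for
  `n ≥ 1` and `|βⱼ| ≤ q` (Stichtenoth Thm. 5.1.15 (a) = `lSeries_eq_polynomial_holds`, Cor. 5.1.16 =
  `exists_pointCount_eq_of_lSeries_eq_polynomial`, eq. (5.40) = `pointCount_eq_weilCount`, and the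
  bound above). Only `|βⱼ| = √q` (Thm. 5.2.1) is missing from Weil's theorem `IsGenus Fq F g`.
* `exists_coe_mul_formalL_eq_of_isFullConstantField_of_smul_eq_map`,
  `isRational_formalL_of_isConstantCurve`, `isRational_formalL_of_isConstantCurve'` — **the constant
  half of `isRational_formalL`, now unconditional**: for an elliptic curve `W` over a global function
  field `F ⊇ 𝔽_q(t)` which is constant over *some* finite field of constants `k → F` (in particular
  over `𝔽_q`, or over the full constant field), `Q · L(E, T) = P` in `ℤ[[T]]` with `Q(0) = 1` and the
  roots of `Q` on `|z| = q^{-1/2}, q^{-3/2}` — Ulmer's Exercise 9.2 with the poles as printed, for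
  every genus of the base curve (previously unconditional only over `F = 𝔽_q(t)`,
  `FunctionFieldEllipticLRationalityConstantProofs`). The proof is that of
  `exists_coe_mul_formalL_eq_of_smul_eq_map` with `ellLFunction_eq_div_of_smul_eq_map_of_norm_le`
  (RH-free Exercise 9.2) fed by `exists_weilCount_eq_of_isFullConstantField`; constancy descends to
  the full constant field by `IsConstantCurve.of_isFullConstantField`.
* `HasLContinuation.of_isConstantCurve`, `hasLContinuation_of_functionField_of_isConstantCurve`,
  `isRational_lFunction_of_functionField_of_isConstantCurve` — the analytic corollaries,
  unconditional: for every constant elliptic curve over every global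
  function field, `L(E, s)` is a rational function of `q^{-s}` continuing meromorphically to `ℂ`,
  holomorphic at `s = 1` (Ulmer, Lecture 1, §9, p. 18: "in all cases `L(E,s)` is holomorphic at
  `s = 1`"), i.e. the predicate `HasLContinuation W` of `FunctionFieldEllipticL` holds outright.
* `isRational_formalL_of_forall_not_isConstantCurve`, `isRational_formalL_of_isGenus_of_theorem93`,
  `isRational_formalL_of_hasseWeil_of_theorem93` — **what the fact still rests on.** Exactly the
  first clause of Theorem 9.3 for the formal series: "`formalL Fq W` is a polynomial when `E` is not
  constant over the full constant field `k` of `F`" (hypothesis `h` of the first theorem; no named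
  fact of the tree states precisely this, the vendored Theorem 9.3
  `ellLFunction_eq_prod_of_not_isConstantCurve k W` being stated through the Weil genus datum
  `IsGenus k F g` and hence consumable only together with the Hasse–Weil theorem `hasseWeil k F`,
  second and third theorems). Theorem 9.3 is Grothendieck's cohomological formula
  `L(E, T) = det(1 - T·Fr_q | H¹(𝒞̄, j_*𝓕))` (Ulmer, Lecture 4, §1.3); étale cohomology and `ℓ`-adic
  Galois representations are absent from Mathlib (v4.32.0) and Literature, so `isRational_formalL`
  is **not discharged** here (SIZE XL, inline-only seat: no split request).
* `isRational_formalL_of_theorem93`, `isRational_formalL_iff_of_not_isConstantCurve` (appended once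
  the Hasse–Weil theorem was **proved** in the tree, `hasseWeil_holds`,
  `FunctionFieldHasseWeilProofs`, Bombieri–Stepanov) — **the fact now rests on Theorem 9.3 alone**:
  `isRational_formalL Fq W` follows from the single named fact
  `ellLFunction_eq_prod_of_not_isConstantCurve k W` over the finite constant fields `k` of `F`
  (the genus datum through which it is stated being supplied by `isGenus_genus_holds`), and at a
  full constant field over which `W` is not constant the fact is *equivalent* to
  "`formalL Fq W ∈ ℤ[T]` up to a denominator with roots on `|z| = q^{-1/2}, q^{-3/2}`" — recorded so
  that the discharge `isRational_formalL_holds` is the one-liner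
  `isRational_formalL_of_theorem93 Fq W (fun k … => ellLFunction_eq_prod_of_not_isConstantCurve_holds k W)`
  the day Theorem 9.3 is proved.

No definition and no new named fact are introduced (D-0026); nothing of
`FunctionFieldEllipticLFormal` or `FunctionFieldEllipticLFormalLeavesProofs` is restated or weakened.

## References

* [Ulmer2011ParkCity] D. Ulmer, *Elliptic curves over function fields*, IAS/Park City Math. Ser.
  18 (2011), Lecture 0, §3; Lecture 1, §9, (9.1), Exercise 9.2, Theorem 9.3; Lecture 4, §1.3
  (arXiv:1101.1939, pp. 5, 18, 48–50).
* [Stichtenoth2009] H. Stichtenoth, *Algebraic Function Fields and Codes*, 2nd ed., GTM 254,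
  Prop. 5.1.8 (Euler product, `Z(t) ≠ 0` for `|t| < q⁻¹`), Cor. 5.1.11, Thm. 5.1.15 (a), (e),
  Cor. 5.1.16, eq. (5.40); §5.2, Thm. 5.2.1 and the convergence-radius argument at (5.22).
* [RosenFunctionFields2002] M. Rosen, *Number Theory in Function Fields*, GTM 210, Ch. 5,
  Thm. 5.9 (F. K. Schmidt) and proof of Thm. 5.12.
* [SilvermanAEC2009] J. H. Silverman, *The Arithmetic of Elliptic Curves*, 2nd ed., Thm. V.2.3.1.
* [Weil1948] A. Weil, *Sur les courbes algébriques et les variétés qui s'en déduisent*, 1948.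
-/

noncomputable section

open scoped Classical Polynomial

open Complex Filter Topology Polynomial Metric

namespace Literature.NumberTheory.EllipticCurves.FunctionField

variable {F : Type} [Field F]

/-! ## The bound `|βⱼ| ≤ q` from the Euler product (Stichtenoth Prop. 5.1.8) -/

section Bound

variable (Fq : Type) [Field Fq] [Fintype Fq]
variable [Algebra Fq[X] F] [Algebra (RatFunc Fq) F] [IsScalarTower Fq[X] (RatFunc Fq) F]
  [FunctionField Fq F]

/-- **`∑ₙ N_n rⁿ/n` converges for `0 ≤ r < q⁻¹`** (complex form): the logarithm of the Euler
product `∏_v (1 - r^{deg v})⁻¹` over the places of the global function field `F / 𝔽_q(t)` is the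
absolutely convergent double series `∑_v ∑_k r^{(k+1) deg v}/(k+1)` (`summable_pow_degree`, i.e. the
tree's `summable_residueCard_rpow_neg`: `∑_v q_v^{-σ} < ∞` for `σ > 1`), which regroups to
`∑ₙ N_n rⁿ/n`, `N_n = ∑_{deg v ∣ n} deg v = weilCount Fq F n` (`hasSum_regroup_dvd`). This is the
first half of the proof of `hasProd_inv_one_sub_pow_degree(_of_norm_le)`
(`FunctionFieldEllipticLConstant(NoRH)Proofs`), which needs no `βⱼ` at all; Stichtenoth
Prop. 5.1.6 / Prop. 5.1.8 ("the right hand side of (5.5) converges absolutely for `|t| < q⁻¹`").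
[cite: Stichtenoth2009, Prop. 5.1.8] [cite: Ulmer2011ParkCity, Lect. 0, §3] -/
theorem summable_weilCount_mul_ofReal_pow_div {r : ℝ} (hr0 : 0 ≤ r)
    (hr : r < (Fintype.card Fq : ℝ)⁻¹) :
    Summable fun n : ℕ => (weilCount Fq F n : ℂ) * (r : ℂ) ^ n / n := by
  set q : ℕ := Fintype.card Fq with hq
  set d : Place F → ℕ := fun v => v.degree q with hddef
  have hd : ∀ v, 0 < d v := fun v => Place.degree_pos_of_finiteDimensional Fq v
  have hq1 : (1 : ℝ) < q := by exact_mod_cast (Fintype.one_lt_card : 1 < q)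
  have hr1 : r < 1 := hr.trans_le (inv_le_one_of_one_le₀ hq1.le)
  set z : ℂ := (r : ℂ) with hz
  -- absolute summability of the double family `A(v, k) = z^{d_v (k+1)}/(k+1)`
  set A : Place F × ℕ → ℂ := fun p => z ^ (d p.1 * (p.2 + 1)) / (p.2 + 1 : ℂ) with hA
  have hAbound : ∀ p : Place F × ℕ, ‖A p‖ ≤ r ^ d p.1 * r ^ p.2 := by
    rintro ⟨v, k⟩
    simp only [hA, norm_div, norm_pow, hz, Complex.norm_real, Real.norm_of_nonneg hr0]
    have hk : (1 : ℝ) ≤ ‖(k + 1 : ℂ)‖ := by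
      rw [← Nat.cast_succ, Complex.norm_natCast]; exact_mod_cast Nat.succ_pos k
    calc r ^ (d v * (k + 1)) / ‖(k + 1 : ℂ)‖ ≤ r ^ (d v * (k + 1)) := div_le_self (by positivity) hk
      _ = r ^ d v * r ^ (d v * k) := by rw [mul_add, mul_one, pow_add, mul_comm]
      _ ≤ r ^ d v * r ^ k := by
        gcongr _ * ?_
        exact pow_le_pow_of_le_one hr0 hr1.le (Nat.le_mul_of_pos_left k (hd v))
  have hsum_r : Summable fun v : Place F => r ^ d v := summable_pow_degree Fq hr0 hr
  have h1 : Summable fun v : Place F => ‖(r ^ d v : ℝ)‖ :=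
    hsum_r.congr fun v => by rw [Real.norm_of_nonneg (pow_nonneg hr0 _)]
  have h2 : Summable fun k : ℕ => ‖(r ^ k : ℝ)‖ := by
    simpa [Real.norm_of_nonneg (pow_nonneg hr0 _)] using summable_geometric_of_lt_one hr0 hr1
  have hg : Summable fun p : Place F × ℕ => r ^ d p.1 * r ^ p.2 :=
    summable_mul_of_summable_norm (f := fun v : Place F => r ^ d v) (g := fun k : ℕ => r ^ k) h1 h2
  have hA_summable : Summable A := Summable.of_norm_bounded hg hAbound
  -- regrouping: `∑_{v,k} A = ∑_n N_n zⁿ / n`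
  set S : ℕ → Finset (Place F) := fun n =>
    if hn : 0 < n then (finite_setOf_degree_dvd Fq (F := F) hn).toFinset else ∅ with hSdef
  have hS : ∀ n, 0 < n → ∀ v, v ∈ S n ↔ d v ∣ n := fun n hn v => by
    simp only [hSdef, hn, dite_true, Set.Finite.mem_toFinset, Set.mem_setOf_eq]
    rfl
  have hregroup := hasSum_regroup_dvd d hd z hA_summable S hS
  have hW : ∀ n, (∑ v ∈ S n, (d v : ℂ)) * z ^ n / n = (weilCount Fq F n : ℂ) * z ^ n / n := by
    intro n
    rcases Nat.eq_zero_or_pos n with rfl | hn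
    · simp
    · rw [weilCount_eq_sum Fq hn]
      simp only [hSdef, hn, dite_true, Nat.cast_sum]
      rfl
  simp only [hW] at hregroup
  exact hregroup.summable

/-- **`∑ₙ N_n rⁿ/n < ∞` for `0 ≤ r < q⁻¹`** (real form of
`summable_weilCount_mul_ofReal_pow_div`): the point counts `N_n = weilCount Fq F n` of a global
function field grow at most like `ρ^{-n}` for every `ρ < q⁻¹`, by the absolute convergence of the
Euler product of `ζ_F` on `|t| < q⁻¹` (Stichtenoth Prop. 5.1.8). No rationality and no Riemann
hypothesis is used. [cite: Stichtenoth2009, Prop. 5.1.8] -/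
theorem summable_weilCount_mul_pow_div {r : ℝ} (hr0 : 0 ≤ r) (hr : r < (Fintype.card Fq : ℝ)⁻¹) :
    Summable fun n : ℕ => (weilCount Fq F n : ℝ) * r ^ n / n := by
  have ha := summable_weilCount_mul_ofReal_pow_div Fq (F := F) hr0 hr
  have h : (fun n : ℕ => (weilCount Fq F n : ℂ) * (r : ℂ) ^ n / n) =
      fun n : ℕ => (((weilCount Fq F n : ℝ) * r ^ n / n : ℝ) : ℂ) := by
    funext n; push_cast; rfl
  rw [h] at ha
  exact Complex.summable_ofReal.mp ha

/-- **The inverse roots of an RH-free Weil form are bounded by `q`** (Stichtenoth Prop. 5.1.8: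
"`Z(t) ≠ 0` for `|t| < q⁻¹`", whence `L(t) = (1 - t)(1 - qt)Z(t) = ∏ (1 - αᵢ t)` has no zero in
that disc and `|αᵢ| ≤ q`; proved by the convergence-radius argument of §5.2 at (5.22)). Let
`F / 𝔽_q(t)` be a global function field and `β` any finite family of complex numbers with
`N_n = qⁿ + 1 - ∑ⱼ βⱼⁿ` for all `n ≥ 1` (`N_n = weilCount Fq F n`). Then `|βⱼ| ≤ q` for every `j`.
Proof: the power sums `pₙ = ∑ⱼ βⱼⁿ = qⁿ + 1 - N_n` satisfy `∑ |pₙ| ρⁿ/n < ∞` for `ρ < q⁻¹`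
(`summable_weilCount_mul_pow_div`), so `G(z) = ∑ₙ pₙ zⁿ/n` is holomorphic on `|z| < ρ`
(`Complex.differentiableOn_tsum_of_summable_norm`); for `z` near `0`,
`G(z) = ∑ⱼ -log(1 - βⱼ z)` (`Complex.hasSum_taylorSeries_neg_log`), i.e.
`exp(-G(z)) = ∏ⱼ (1 - βⱼ z)`; by the identity theorem
(`AnalyticOnNhd.eqOn_of_preconnected_of_eventuallyEq`) this persists on the whole disc, where
`exp(-G) ≠ 0` — so `1/βⱼ`, a zero of the product, has `|1/βⱼ| ≥ q⁻¹`. The hypothesis is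
satisfiable when `𝔽_q` is the full constant field (`exists_weilCount_eq_of_isFullConstantField`);
`𝔽_q` need not be the full constant field here. [cite: Stichtenoth2009, Prop. 5.1.8 and §5.2, (5.22)] -/
theorem norm_le_card_of_weilCount_eq {ι : Type} [Fintype ι] {β : ι → ℂ}
    (hN : ∀ n : ℕ, 0 < n →
      (weilCount Fq F n : ℂ) = (Fintype.card Fq : ℂ) ^ n + 1 - ∑ j, β j ^ n) (j : ι) :
    ‖β j‖ ≤ (Fintype.card Fq : ℝ) := by
  set q : ℕ := Fintype.card Fq with hq
  have hq1 : (1 : ℝ) < q := by exact_mod_cast (Fintype.one_lt_card : 1 < q)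
  have hq0 : (0 : ℝ) < q := zero_lt_one.trans hq1
  by_contra hlt
  rw [not_le] at hlt
  have hβpos : 0 < ‖β j‖ := hq0.trans hlt
  have hβ0 : β j ≠ 0 := norm_pos_iff.mp hβpos
  -- the putative zero `t₀ = 1/βⱼ` of `∏ (1 - βᵢ t)` inside the disc `|t| < 1/q`
  set t₀ : ℂ := (β j)⁻¹ with ht₀
  have ht₀n : ‖t₀‖ < (q : ℝ)⁻¹ := by
    rw [ht₀, norm_inv]; exact (inv_lt_inv₀ hβpos hq0).mpr hlt
  obtain ⟨ρ, hρ1, hρ2⟩ := exists_between ht₀n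
  have hρ0 : 0 < ρ := (norm_nonneg _).trans_lt hρ1
  have hρq : (q : ℝ) * ρ < 1 := by
    have := mul_lt_mul_of_pos_left hρ2 hq0
    rwa [mul_inv_cancel₀ hq0.ne'] at this
  have hρ1' : ρ < 1 := hρ2.trans_le (inv_le_one_of_one_le₀ hq1.le)
  -- power sums `p_n = ∑ βᵢⁿ = qⁿ + 1 - N_n`
  set p : ℕ → ℂ := fun n => ∑ i, β i ^ n with hp
  have hpN : ∀ n, 0 < n → p n = (q : ℂ) ^ n + 1 - (weilCount Fq F n : ℂ) := fun n hn => by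
    rw [hN n hn]; ring
  have hpnorm : ∀ n, 0 < n → ‖p n‖ ≤ (q : ℝ) ^ n + 1 + (weilCount Fq F n : ℝ) := fun n hn => by
    rw [hpN n hn]
    refine (norm_sub_le _ _).trans (add_le_add ((norm_add_le _ _).trans ?_) ?_)
    · rw [norm_pow, Complex.norm_natCast, norm_one]
    · rw [Complex.norm_natCast]
  -- the generating function `G(z) = ∑ p_n zⁿ / n`, analytic on the ball of radius `ρ`
  set U : Set ℂ := ball (0 : ℂ) ρ with hU
  set G : ℂ → ℂ := fun z => ∑' n : ℕ, p n * z ^ n / n with hG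
  set u : ℕ → ℝ := fun n => ‖p n‖ * ρ ^ n / n with hu
  have hu_summable : Summable u := by
    have hs1 : Summable fun n : ℕ => (weilCount Fq F n : ℝ) * ρ ^ n / n :=
      summable_weilCount_mul_pow_div Fq hρ0.le hρ2
    have hs2 : Summable fun n : ℕ => ((q : ℝ) ^ n + 1) * ρ ^ n := by
      have hg1 : Summable fun n : ℕ => ((q : ℝ) * ρ) ^ n :=
        summable_geometric_of_lt_one (by positivity) hρq
      have hg2 : Summable fun n : ℕ => ρ ^ n := summable_geometric_of_lt_one hρ0.le hρ1'
      refine (hg1.add hg2).congr fun n => ?_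
      rw [mul_pow]; ring
    refine Summable.of_nonneg_of_le (fun n => by positivity) (fun n => ?_) (hs2.add hs1)
    rcases Nat.eq_zero_or_pos n with rfl | hn
    · simp [hu]
    · have hn1 : (1 : ℝ) ≤ n := by exact_mod_cast hn
      calc u n = ‖p n‖ * ρ ^ n / n := rfl
        _ ≤ ((q : ℝ) ^ n + 1 + weilCount Fq F n) * ρ ^ n / n := by gcongr; exact hpnorm n hn
        _ = ((q : ℝ) ^ n + 1) * ρ ^ n / n + (weilCount Fq F n : ℝ) * ρ ^ n / n := by ring
        _ ≤ ((q : ℝ) ^ n + 1) * ρ ^ n + (weilCount Fq F n : ℝ) * ρ ^ n / n := by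
          gcongr; exact div_le_self (by positivity) hn1
  have hGdiff : DifferentiableOn ℂ G U := by
    refine Complex.differentiableOn_tsum_of_summable_norm hu_summable
      (fun n => (((differentiable_const (p n)).mul (differentiable_pow n)).div_const
        (n : ℂ)).differentiableOn) isOpen_ball (fun n w hw => ?_)
    rw [mem_ball_zero_iff] at hw
    simp only [hu, norm_div, norm_mul, norm_pow, Complex.norm_natCast]
    gcongr
  have hGan : AnalyticOnNhd ℂ G U := hGdiff.analyticOnNhd isOpen_ball
  -- `f = ∏ (1 - βᵢ t)` (a polynomial) and `g = exp(-G)`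
  set fp : ℂ[X] := ∏ i, (1 - Polynomial.C (β i) * X) with hfp
  have hfp_eval : ∀ z : ℂ, fp.eval z = ∏ i, (1 - β i * z) := fun z => by
    rw [hfp, eval_prod]; simp
  set f : ℂ → ℂ := fun z => fp.eval z with hf
  set g : ℂ → ℂ := fun z => Complex.exp (-G z) with hg
  have hfan : AnalyticOnNhd ℂ f U := fp.differentiable.differentiableOn.analyticOnNhd isOpen_ball
  have hgan : AnalyticOnNhd ℂ g U := hGdiff.neg.cexp.analyticOnNhd isOpen_ball
  -- `f = g` near `0`: there `G(z) = ∑ᵢ -log(1 - βᵢ z)`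
  set M : ℝ := ∑ i, ‖β i‖ with hM
  have hM0 : 0 ≤ M := Finset.sum_nonneg fun i _ => norm_nonneg _
  have hMi : ∀ i, ‖β i‖ ≤ M := fun i =>
    Finset.single_le_sum (f := fun i => ‖β i‖) (fun i _ => norm_nonneg _) (Finset.mem_univ i)
  set δ : ℝ := min ρ (1 / (M + 1)) with hδ
  have hδ0 : 0 < δ := lt_min hρ0 (by positivity)
  have hδρ : δ ≤ ρ := min_le_left _ _
  have hδM : ∀ i, ‖β i‖ * δ < 1 := fun i => by
    calc ‖β i‖ * δ ≤ M * (1 / (M + 1)) := by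
          gcongr
          · exact hMi i
          · exact min_le_right _ _
      _ < 1 := by rw [mul_one_div, div_lt_one (by positivity)]; linarith
  have hfg : f =ᶠ[𝓝 0] g := by
    refine Filter.eventuallyEq_of_mem (Metric.ball_mem_nhds (0 : ℂ) hδ0) fun z hz => ?_
    rw [mem_ball_zero_iff] at hz
    have hβz : ∀ i, ‖β i * z‖ < 1 := fun i => by
      rw [norm_mul]
      exact (mul_le_mul_of_nonneg_left hz.le (norm_nonneg _)).trans_lt (hδM i)
    have hne : ∀ i, (1 : ℂ) - β i * z ≠ 0 := fun i =>
      sub_ne_zero.mpr fun h => (hβz i).ne (by rw [← h, norm_one])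
    have hGz : HasSum (fun n : ℕ => p n * z ^ n / n) (∑ i, -Complex.log (1 - β i * z)) := by
      have h3 : HasSum (fun n : ℕ => ∑ i, (β i * z) ^ n / n) (∑ i, -Complex.log (1 - β i * z)) :=
        hasSum_sum fun i _ => Complex.hasSum_taylorSeries_neg_log (hβz i)
      refine h3.congr_fun fun n => ?_
      simp only [hp, mul_pow, Finset.sum_mul, Finset.sum_div]
    show fp.eval z = Complex.exp (-G z)
    rw [hfp_eval, hG]
    dsimp only
    rw [hGz.tsum_eq, ← Finset.sum_neg_distrib, Complex.exp_sum]
    simp only [neg_neg]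
    exact Finset.prod_congr rfl fun i _ => (Complex.exp_log (hne i)).symm
  -- identity theorem on the ball, and the contradiction at `t₀`
  have heq : Set.EqOn f g U :=
    hfan.eqOn_of_preconnected_of_eventuallyEq hgan (convex_ball (0 : ℂ) ρ).isPreconnected
      (mem_ball_self hρ0) hfg
  have ht₀U : t₀ ∈ U := mem_ball_zero_iff.mpr hρ1
  have hft₀ : f t₀ = 0 := by
    show fp.eval t₀ = 0
    rw [hfp_eval]
    exact Finset.prod_eq_zero (Finset.mem_univ j) (by rw [ht₀, mul_inv_cancel₀ hβ0, sub_self])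
  have := heq ht₀U
  rw [hft₀] at this
  exact Complex.exp_ne_zero _ this.symm

end Bound

/-! ## The RH-free Weil form of `ζ_F` from F. K. Schmidt's theorem -/

section WeilForm

variable (Fq : Type) [Field Fq] [Fintype Fq]
variable [Algebra Fq[X] F] [Algebra (RatFunc Fq) F] [IsScalarTower Fq[X] (RatFunc Fq) F]
  [FunctionField Fq F]

/-- **The RH-free Weil form of `ζ_F` (F. K. Schmidt's rationality theorem with the trivial bound),
proved.** Let `F / 𝔽_q(t)` be a global function field with a compatible `𝔽_q`-algebra structure for
which `𝔽_q` is the full constant field (`IsIntegrallyClosedIn Fq F`), and let `g = genus Fq F` be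
its Riemann–Roch genus. Then there are complex numbers `β₁, …, β_{2g}`, all nonzero, with
`N_n = qⁿ + 1 - ∑ⱼ βⱼⁿ` for every `n ≥ 1` and `|βⱼ| ≤ q`: the reciprocals of the roots of the
`L`-polynomial `L_F(t) = (1 - t)(1 - qt) Z_F(t) ∈ ℤ[t]`, `deg L_F = 2g` (Stichtenoth Thm. 5.1.15 (a),
**proved** in the tree as `lSeries_eq_polynomial_holds` from F. K. Schmidt's `∂ = 1`), which satisfy
Cor. 5.1.16 (`exists_pointCount_eq_of_lSeries_eq_polynomial`, with eq. (5.40)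
`pointCount_eq_weilCount`) and the bound of Prop. 5.1.8 (`norm_le_card_of_weilCount_eq`). Weil's
Riemann hypothesis `|βⱼ| = √q` (Thm. 5.2.1, the named fact `hasseWeil`, open in the tree) is exactly
what separates this from `IsGenus Fq F g`. [cite: Stichtenoth2009, Thm. 5.1.15(a), Cor. 5.1.16,
Prop. 5.1.8] [cite: RosenFunctionFields2002, Ch. 5, Thm. 5.9] -/
theorem exists_weilCount_eq_of_isIntegrallyClosedIn [Algebra Fq F] [IsScalarTower Fq Fq[X] F]
    [IsIntegrallyClosedIn Fq F] :
    ∃ β : Fin (2 * DiophantineGeometry.AlgFunctionField.genus Fq F) → ℂ,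
      (∀ j, β j ≠ 0) ∧ (∀ j, ‖β j‖ ≤ (Fintype.card Fq : ℝ)) ∧
      ∀ n : ℕ, 0 < n →
        (weilCount Fq F n : ℂ) = (Fintype.card Fq : ℂ) ^ n + 1 - ∑ j, β j ^ n := by
  haveI := isAlgFunctionField_of_functionField Fq F
  obtain ⟨β, hβ0, hN⟩ :=
    DiophantineGeometry.AlgFunctionField.exists_pointCount_eq_of_lSeries_eq_polynomial (K := Fq)
      (F := F) DiophantineGeometry.AlgFunctionField.lSeries_eq_polynomial_holds
  have hN' : ∀ n : ℕ, 0 < n →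
      (weilCount Fq F n : ℂ) = (Fintype.card Fq : ℂ) ^ n + 1 - ∑ j, β j ^ n := fun n hn => by
    rw [← DiophantineGeometry.AlgFunctionField.pointCount_eq_weilCount hn]; exact hN n hn
  exact ⟨β, hβ0, fun j => norm_le_card_of_weilCount_eq Fq hN' j, hN'⟩

/-- **The RH-free Weil form over the bare instance stack.** For a global function field
`F / 𝔽_q(t)` (only `[Algebra Fq[X] F] …`, the `𝔽_q`-algebra structure being `𝔽_q → 𝔽_q[X] → F` as
inside `IsFullConstantField`) whose full constant field is `𝔽_q`, there is a finite family `β` with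
`N_n = qⁿ + 1 - ∑ⱼ βⱼⁿ` for all `n ≥ 1` and `|βⱼ| ≤ q` — the input of the RH-free Exercise 9.2 of
`FunctionFieldEllipticLConstantNoRHProofs` (`ellLFunction_eq_div_of_smul_eq_map_of_norm_le`,
`HasLContinuation.of_isConstantCurve_of_weilCount_eq`), now supplied unconditionally.
[cite: Stichtenoth2009, Thm. 5.1.15(a), Cor. 5.1.16, Prop. 5.1.8] -/
theorem exists_weilCount_eq_of_isFullConstantField (hFq : IsFullConstantField Fq F) :
    ∃ (m : ℕ) (β : Fin m → ℂ), (∀ j, ‖β j‖ ≤ (Fintype.card Fq : ℝ)) ∧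
      ∀ n : ℕ, 0 < n →
        (weilCount Fq F n : ℂ) = (Fintype.card Fq : ℂ) ^ n + 1 - ∑ j, β j ^ n := by
  letI : Algebra Fq F := ((algebraMap Fq[X] F).comp Polynomial.C).toAlgebra
  haveI : IsScalarTower Fq Fq[X] F := IsScalarTower.of_algebraMap_eq fun c => by
    rw [RingHom.algebraMap_toAlgebra, RingHom.comp_apply, Polynomial.C_eq_algebraMap]
  haveI : IsIntegrallyClosedIn Fq F := (isFullConstantField_iff_isIntegrallyClosedIn Fq F).mp hFq
  obtain ⟨β, -, hβ, hN⟩ := exists_weilCount_eq_of_isIntegrallyClosedIn Fq (F := F)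
  exact ⟨_, β, hβ, hN⟩

end WeilForm

/-! ## Constant curves: change of constant field -/

section ConstantField

variable {k' k : Type} [Field k'] [Fintype k'] [Field k] [Algebra k'[X] F] [Algebra k[X] F]

/-- **Constancy descends to the full constant field.** If `W / F` is constant over a *finite*
field of constants `k' → F` (`e • W = W₀ ⊗_{k'} F`), then it is constant over the full constant field
`k` of `F`: the finite field `k'` lands in `k` (`exists_ringHom_comp_eq_of_isFullConstantField`: its
elements are roots of `X^{q'} - X`, hence algebraic over `k`), and `W₀ ⊗_{k'} F = (W₀ ⊗_{k'} k) ⊗_k F`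
(`WeierstrassCurve.map_map`). Ulmer (2011), Lecture 1, §1 ("`E` is constant if it can be defined by a
Weierstrass cubic where the `aᵢ ∈ k`", `k` the field of constants).
[cite: Ulmer2011ParkCity, Lect. 1, §1, Definitions] -/
theorem IsConstantCurve.of_isFullConstantField {W : WeierstrassCurve F} (h : IsConstantCurve k' W)
    (hk : IsFullConstantField k F) : IsConstantCurve k W := by
  obtain ⟨W₀, e', he'⟩ := h
  obtain ⟨ι, hι⟩ := exists_ringHom_comp_eq_of_isFullConstantField k' k hk
    ((algebraMap k'[X] F).comp Polynomial.C)
  exact ⟨W₀.map ι, e', by rw [he', ← hι, WeierstrassCurve.map_map]⟩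

end ConstantField

/-! ## The constant case, unconditionally -/

section Constant

variable (Fq : Type) [Field Fq] [Fintype Fq] [Algebra Fq[X] F]
  [Algebra (RatFunc Fq) F] [IsScalarTower Fq[X] (RatFunc Fq) F] [FunctionField Fq F]
variable (k : Type) [Field k] [Fintype k] [Algebra k[X] F] [Algebra (RatFunc k) F]
  [IsScalarTower k[X] (RatFunc k) F] [FunctionField k F]
variable (W : WeierstrassCurve F)

/-- **Constant `E ≅ E₀ ×_k F`: `Q · L(E, T) = P` with the poles on the two circles —
unconditionally.** Let `F` carry two global-function-field structures, over `𝔽_q` and over a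
finite field `k` which is the full constant field of `F` (`#k = q' = q^m`), and let
`e • W = W₀ ⊗_k F` for an admissible change of variables `e`, `W` elliptic. Then there are
`P, Q ∈ ℤ[T]`, `Q(0) = 1`, all complex roots of `Q` on `|z| = q^{-1/2}` or `|z| = q^{-3/2}`, with
`Q · formalL Fq W = P`: `Q = Q₀(T^m)` for the printed denominator
`Q₀ = ∏ᵢ (1 - αᵢ u)(1 - αᵢ q' u) = (1 - au + q'u²)(1 - q'au + q'³u²)`
(`α₁ + α₂ = a = q' + 1 - #E₀(k)`, `α₁α₂ = q'`, `|αᵢ| = √q'` — Hasse, proved in the tree as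
`WeierstrassCurve.card_point_baseChange_eq_holds`) and `P = ∏_{i,j} (1 - αᵢβⱼ T^m)` over `ℂ` for
the RH-free Weil form `βⱼ` of `ζ_F` (`exists_weilCount_eq_of_isFullConstantField`: F. K. Schmidt's
theorem, proved). The identity on `Re s > 3/2` is Ulmer's Exercise 9.2 in its RH-free form
`ellLFunction_eq_div_of_smul_eq_map_of_norm_le` (`FunctionFieldEllipticLConstantNoRHProofs`),
transported to `ℤ[[T]]` by `exists_coe_mul_formalL_eq_of_ellLFunction_eq`. Same proof as
`exists_coe_mul_formalL_eq_of_smul_eq_map` (which assumed Weil's theorem `IsGenus k F g`); relies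
on no hypothesis beyond `hk`, `he`. [cite: Ulmer2011ParkCity, Lect. 1, §9, Exercise 9.2]
[cite: Stichtenoth2009, Thm. 5.1.15(a) and Prop. 5.1.8] -/
theorem exists_coe_mul_formalL_eq_of_isFullConstantField_of_smul_eq_map [W.IsElliptic]
    (hk : IsFullConstantField k F)
    {W₀ : WeierstrassCurve k} {e : WeierstrassCurve.VariableChange F}
    (he : e • W = W₀.map ((algebraMap k[X] F).comp Polynomial.C)) :
    ∃ P Q : ℤ[X], Q.coeff 0 = 1 ∧
      (∀ z ∈ (Q.map (Int.castRingHom ℂ)).roots,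
        ‖z‖ = (Fintype.card Fq : ℝ) ^ (-(1 / 2 : ℝ)) ∨
          ‖z‖ = (Fintype.card Fq : ℝ) ^ (-(3 / 2 : ℝ))) ∧
      (Q : PowerSeries ℤ) * formalL Fq W = P := by
  haveI : W₀.IsElliptic := isElliptic_of_smul_eq_map he
  obtain ⟨α, β, hsum, hprod, hα, hβ, hcount⟩ :=
    WeierstrassCurve.card_point_baseChange_eq.exists_roots W₀
      (WeierstrassCurve.card_point_baseChange_eq_holds W₀)
  obtain ⟨m', γ, hγ, hN⟩ := exists_weilCount_eq_of_isFullConstantField k hk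
  obtain ⟨ι, -⟩ := exists_ringHom_comp_eq_of_isFullConstantField Fq k hk
    ((algebraMap Fq[X] F).comp Polynomial.C)
  obtain ⟨m, hm0, hm⟩ := exists_card_eq_pow_of_ringHom ι
  have hq0 : Fintype.card Fq ≠ 0 := Fintype.card_ne_zero
  have hq'0 : Fintype.card k ≠ 0 := Fintype.card_ne_zero
  have hq'pos : 0 < Fintype.card k := Fintype.card_pos
  -- Exercise 9.2, RH-free in the base curve, with the Frobenius roots of `E₀` and the `βⱼ` of `ζ_F`
  set αv : Fin 2 → ℂ := ![α, β] with hαv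
  have hαnorm : ∀ i, ‖αv i‖ = √(Fintype.card k : ℝ) := by
    intro i; fin_cases i <;> simp [hαv, hα, hβ]
  have hcount' : ∀ (K : Type) [Field K] [Fintype K] [Algebra k K],
      (Nat.card (W₀.baseChange K).toAffine.Point : ℂ) =
        (Fintype.card k : ℂ) ^ Module.finrank k K + 1 - ∑ i, αv i ^ Module.finrank k K := by
    intro K _ _ _
    rw [hcount K, Fin.sum_univ_two]
    simp [hαv]
    ring
  have hprod' : αv 0 * αv 1 = Fintype.card k := by simpa [hαv] using hprod
  have hL : ∀ s : ℂ, (3 / 2 : ℝ) < s.re → ellLFunction W s =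
      (∏ i, ∏ j, (1 - αv i * γ j * (Fintype.card k : ℂ) ^ (-s))) /
        ((∏ i, (1 - αv i * (Fintype.card k : ℂ) ^ (-s))) *
          ∏ i, (1 - αv i * (Fintype.card k : ℂ) ^ (1 - s))) := fun s hs =>
    ellLFunction_eq_div_of_smul_eq_map_of_norm_le k he hcount' hprod' hαnorm hN hγ hs
  -- the integer denominator `Q₀(T^m)` and the complex numerator `∏ (1 - αᵢ βⱼ T^m)`
  set a : ℤ := (Fintype.card k : ℤ) + 1 - (Nat.card W₀.toAffine.Point : ℤ) with ha
  set Q₀ : ℤ[X] := (1 - C a * X + C (Fintype.card k : ℤ) * X ^ 2) *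
    (1 - C ((Fintype.card k : ℤ) * a) * X + C ((Fintype.card k : ℤ) ^ 3) * X ^ 2) with hQ₀
  set Pc : ℂ[X] := ∏ i, ∏ j, (1 - C (αv i * γ j) * X ^ m) with hPc
  have hPc_eval : ∀ T : ℂ, Pc.eval T = ∏ i, ∏ j, (1 - αv i * γ j * T ^ m) := fun T => by
    rw [hPc, eval_prod]; simp [eval_prod]
  have hPc0 : Pc.coeff 0 = 1 := by
    rw [coeff_zero_eq_eval_zero, hPc_eval, zero_pow hm0.ne']; simp
  have hQ0 : (expand ℤ m Q₀).coeff 0 = 1 := by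
    rw [coeff_expand hm0, if_pos (dvd_zero m), Nat.zero_div, hQ₀, coeff_zero_denominator]
  -- `u = q'^{-s} = (q^{-s})^m`
  have hu : ∀ s : ℂ, (Fintype.card k : ℂ) ^ (-s) = ((Fintype.card Fq : ℂ) ^ (-s)) ^ m :=
    fun s => by rw [hm, natCast_pow_cpow_neg _ _ hq0]
  have hid : ∀ s : ℂ, (3 / 2 : ℝ) < s.re →
      aeval ((Fintype.card Fq : ℂ) ^ (-s)) (expand ℤ m Q₀) * ellLFunction W s =
        Pc.eval ((Fintype.card Fq : ℂ) ^ (-s)) := by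
    intro s hs
    have hden : aeval ((Fintype.card Fq : ℂ) ^ (-s)) (expand ℤ m Q₀) =
        (∏ i, (1 - αv i * (Fintype.card k : ℂ) ^ (-s))) *
          ∏ i, (1 - αv i * (Fintype.card k : ℂ) ^ (1 - s)) := by
      rw [expand_aeval, ← hu s, hQ₀, aeval_denominator_eq hsum hprod, natCast_cpow_one_sub hq'0,
        Fin.prod_univ_two, Fin.prod_univ_two]
      simp [hαv]
    have hD : (∏ i, (1 - αv i * (Fintype.card k : ℂ) ^ (-s))) *
        ∏ i, (1 - αv i * (Fintype.card k : ℂ) ^ (1 - s)) ≠ 0 := by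
      refine mul_ne_zero (Finset.prod_ne_zero_iff.mpr fun i _ => ?_)
        (Finset.prod_ne_zero_iff.mpr fun i _ => ?_)
      · exact (one_sub_mul_card_cpow_ne_zero k (hαnorm i) hs).1
      · rw [natCast_cpow_one_sub hq'0]
        exact (one_sub_mul_card_cpow_ne_zero k (hαnorm i) hs).2
    rw [hL s hs, ← mul_div_assoc, hden, mul_div_cancel_left₀ _ hD, hPc_eval, ← hu s]
  obtain ⟨P, -, hP⟩ := exists_coe_mul_formalL_eq_of_ellLFunction_eq Fq W hQ0 hPc0 hid
  refine ⟨P, expand ℤ m Q₀, hQ0, fun z hz => ?_, hP⟩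
  -- `z^m` is a root of `Q₀`, hence `|z|^m = q'^{-1/2}` or `q'^{-3/2}`
  rw [map_expand, mem_roots', IsRoot.def, expand_eval, eval_map, ← algebraMap_int_eq,
    ← aeval_def] at hz
  have hw := norm_eq_rpow_of_aeval_denominator_eq_zero hq'pos hsum hprod hα hβ hz.2
  rw [norm_pow] at hw
  have hqR : (0 : ℝ) ≤ Fintype.card Fq := Nat.cast_nonneg _
  have hcast : ((Fintype.card k : ℝ)) = (Fintype.card Fq : ℝ) ^ m := by rw [hm]; push_cast; rfl
  rcases hw with hw | hw
  · exact Or.inl (norm_eq_rpow_of_norm_pow_eq hm0.ne' hqR (by rw [hw, hcast]))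
  · exact Or.inr (norm_eq_rpow_of_norm_pow_eq hm0.ne' hqR (by rw [hw, hcast]))

/-- **`isRational_formalL Fq W` for curves constant over the full constant field — proved.**
Let `F` carry global-function-field structures over `𝔽_q` and over its full constant field `k`. If
`W` is constant over `k` (Ulmer: "`E ≅ E₀ ×_k K`"), then the named fact `isRational_formalL Fq W` of
`FunctionFieldEllipticLFormal` holds: for elliptic `W`, `Q · L(E, T) = P` in `ℤ[[T]]`, `Q(0) = 1`,
poles on `|T| = q^{-1/2}, q^{-3/2}` — Ulmer's Exercise 9.2 ("its poles lie on the lines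
`Re s = 1/2` and `Re s = 3/2`"), with no hypothesis on `ζ_F`. Relies on: nothing beyond `hk`, `hc`
(F. K. Schmidt's theorem and Hasse's theorem for `E₀` are theorems of the tree).
[cite: Ulmer2011ParkCity, Lect. 1, §9, Exercise 9.2] -/
theorem isRational_formalL_of_isConstantCurve (hk : IsFullConstantField k F)
    (hc : IsConstantCurve k W) : isRational_formalL Fq W := by
  intro _
  obtain ⟨W₀, e, he⟩ := hc
  exact exists_coe_mul_formalL_eq_of_isFullConstantField_of_smul_eq_map Fq k W hk he

end Constant

/-! ## Constant over any finite field of constants: the unconditional corollaries -/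

section AnyConstantField

variable (Fq : Type) [Field Fq] [Fintype Fq] [Algebra Fq[X] F]
  [Algebra (RatFunc Fq) F] [IsScalarTower Fq[X] (RatFunc Fq) F] [FunctionField Fq F]
variable (k : Type) [Field k] [Finite k] [Algebra k[X] F]
variable (W : WeierstrassCurve F)

/-- **`isRational_formalL Fq W` for every constant curve — proved.** If `W / F` is constant over
*some* finite field of constants `k → F` (only `[Algebra k[X] F]` is needed to say so; e.g. `k = 𝔽_q`
itself), then `isRational_formalL Fq W` holds for every global-function-field structure `F ⊇ 𝔽_q(t)`:
pass to the full constant field `k₀ ⊇ 𝔽_q` of `F` (`exists_functionField_isFullConstantField`), over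
which `W` is still constant (`IsConstantCurve.of_isFullConstantField`), and apply
`isRational_formalL_of_isConstantCurve`. This is the constant half of the provefact target, closed.
[cite: Ulmer2011ParkCity, Lect. 1, §9, Exercise 9.2] -/
theorem isRational_formalL_of_isConstantCurve' (hc : IsConstantCurve k W) :
    isRational_formalL Fq W := by
  haveI : Fintype k := Fintype.ofFinite k
  intro _
  obtain ⟨k₀, _, _, _, _, _, hFF, hfull⟩ := exists_functionField_isFullConstantField Fq F
  haveI := hFF
  exact isRational_formalL_of_isConstantCurve Fq k₀ W hfull (hc.of_isFullConstantField hfull)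

include Fq in
/-- **`L(E, s)` of a constant elliptic curve over a global function field continues to `ℂ`,
holomorphically at `s = 1` — unconditionally.** For an elliptic curve `W` over a global function
field `F ⊇ 𝔽_q(t)` which is constant over some finite field of constants `k → F`, the predicate
`HasLContinuation W` of `FunctionFieldEllipticL` holds (Ulmer (2011), Lecture 1, §9, p. 18:
`L(E, s)` "extends to a meromorphic function of `s`", "in all cases `L(E,s)` is holomorphic at
`s = 1`"): the RH-free Exercise 9.2 `HasLContinuation.of_isConstantCurve_of_weilCount_eq` of
`FunctionFieldEllipticLConstantNoRHProofs` at the full constant field `k₀` of `F`, fed by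
`exists_weilCount_eq_of_isFullConstantField k₀`. Previously unconditional only over `F = 𝔽_q(t)`
(`HasLContinuation.of_isConstantCurve_ratFunc`). `Fq` only serves to produce `k₀`.
[cite: Ulmer2011ParkCity, Lect. 1, §9, Exercise 9.2] -/
theorem HasLContinuation.of_isConstantCurve [W.IsElliptic] (hc : IsConstantCurve k W) :
    HasLContinuation W := by
  haveI : Fintype k := Fintype.ofFinite k
  obtain ⟨k₀, _, _, _, _, _, hFF, hfull⟩ := exists_functionField_isFullConstantField Fq F
  haveI := hFF
  obtain ⟨m, β, hβ, hN⟩ := exists_weilCount_eq_of_isFullConstantField k₀ hfull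
  exact HasLContinuation.of_isConstantCurve_of_weilCount_eq k₀ W (hc.of_isFullConstantField hfull)
    β hN hβ

/-- The corrected named fact `hasLContinuation_of_functionField Fq W` of `FunctionFieldEllipticL`
at every constant curve, unconditionally. [cite: Ulmer2011ParkCity, Lect. 1, §9, Exercise 9.2] -/
theorem hasLContinuation_of_functionField_of_isConstantCurve (hc : IsConstantCurve k W) :
    hasLContinuation_of_functionField Fq W := by
  intro _
  exact HasLContinuation.of_isConstantCurve Fq k W hc

/-- **Grothendieck rationality of `L(E, s)` for constant curves — unconditionally.** The
corrected named fact `isRational_lFunction_of_functionField Fq W` of `FunctionFieldEllipticL`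
(some `s ↦ P(q^{-s})/Q(q^{-s})`, `P, Q ∈ ℤ[T]`, `Q ≠ 0`, is an admissible continuation of the Euler
product) at every curve constant over a finite field of constants `k → F`, by
`isRational_lFunction_of_functionField_of_isRational_formalL` (`FunctionFieldEllipticLFormalProofs`)
and `isRational_formalL_of_isConstantCurve'`. Previously known in the tree only over `F = 𝔽_q(t)`
(`isRational_lFunction_of_functionField_of_isConstantCurve_ratFunc`).
[cite: Ulmer2011ParkCity, Lect. 1, §9, Exercise 9.2] -/
theorem isRational_lFunction_of_functionField_of_isConstantCurve (hc : IsConstantCurve k W) :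
    isRational_lFunction_of_functionField Fq W :=
  isRational_lFunction_of_functionField_of_isRational_formalL Fq W
    (isRational_formalL_of_isConstantCurve' Fq k W hc)

end AnyConstantField

/-! ## Assembly: what the fact still rests on -/

section Assembly

variable (Fq : Type) [Field Fq] [Fintype Fq] [Algebra Fq[X] F]
  [Algebra (RatFunc Fq) F] [IsScalarTower Fq[X] (RatFunc Fq) F] [FunctionField Fq F]
  (W : WeierstrassCurve F)

/-- **What `isRational_formalL` still rests on: the first clause of Theorem 9.3 for the formal
series.** For every global function field `F ⊇ 𝔽_q(t)` and every `W / F`, the named fact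
`isRational_formalL Fq W` follows from the single statement: *over every finite full constant field
`k` of `F` (with a compatible global-function-field structure), if `W` is elliptic and not constant
over `k` then `formalL Fq W` is a polynomial* — Ulmer's Theorem 9.3, "`L(E, s)` is a polynomial in
`q^{-s}`" for non-constant `E`, read for the formal series of (9.1) (Grothendieck's cohomological
formula with `H⁰ = H² = 0`, Lecture 4, §1.3; not in the tree). The constant case is the theorem
`isRational_formalL_of_isConstantCurve` (no hypothesis). Relies on: hypothesis `h` only.
[cite: Ulmer2011ParkCity, Lect. 1, §9, Thm. 9.3 and Exercise 9.2] -/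
theorem isRational_formalL_of_forall_not_isConstantCurve
    (h : ∀ (k : Type) [Field k] [Fintype k] [Algebra k[X] F] [Algebra (RatFunc k) F]
      [IsScalarTower k[X] (RatFunc k) F] [FunctionField k F] [W.IsElliptic],
      IsFullConstantField k F → ¬ IsConstantCurve k W → ∃ P : ℤ[X], formalL Fq W = P) :
    isRational_formalL Fq W := by
  intro hE
  obtain ⟨k, _, _, _, _, _, hFF, hfull⟩ := exists_functionField_isFullConstantField Fq F
  haveI := hFF
  by_cases hc : IsConstantCurve k W
  · exact isRational_formalL_of_isConstantCurve Fq k W hfull hc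
  · obtain ⟨P, hP⟩ := h k hfull hc
    refine ⟨P, 1, by simp, fun z hz => ?_, by rw [Polynomial.coe_one, one_mul, hP]⟩
    simp at hz

/-- **From the vendored Theorem 9.3 at the full constant field.** `isRational_formalL Fq W`
follows from Ulmer's Theorem 9.3 as vendored (`ellLFunction_eq_prod_of_not_isConstantCurve k W`,
which is stated through — and therefore consumable only with — a Weil genus datum `IsGenus k F g`
of the full constant field `k`), the constant case being unconditional. Compare
`isRational_formalL_of_isFullConstantField_of_facts` (`FunctionFieldEllipticLFormalLeavesProofs`),
where the genus datum was also needed for the constant case. Relies on: hypotheses `hg` (Weil's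
theorem for `F/k`, only to invoke `h93`) and `h93` (named fact, Grothendieck–Deligne).
[cite: Ulmer2011ParkCity, Lect. 1, §9, Thm. 9.3 and Exercise 9.2] -/
theorem isRational_formalL_of_isGenus_of_theorem93 (k : Type) [Field k] [Fintype k] [Algebra k[X] F]
    [Algebra (RatFunc k) F] [IsScalarTower k[X] (RatFunc k) F] [FunctionField k F]
    (hk : IsFullConstantField k F) {g : ℕ} (hg : IsGenus k F g)
    (h93 : ellLFunction_eq_prod_of_not_isConstantCurve k W) : isRational_formalL Fq W := by
  intro hE
  by_cases hc : IsConstantCurve k W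
  · exact isRational_formalL_of_isConstantCurve Fq k W hk hc
  · obtain ⟨P, -, hP⟩ := formalL_eq_polynomial_of_not_isConstantCurve Fq k W hk hg hc h93
    refine ⟨P, 1, by simp, fun z hz => ?_, by rw [Polynomial.coe_one, one_mul, hP]⟩
    simp at hz

/-- **From the Hasse–Weil theorem and Ulmer's Theorem 9.3, over every constant field.**
`isRational_formalL Fq W` granted, over the finite constant fields `k` of `F`, Stichtenoth Thm. 5.2.1
(`hasseWeil k F`, the Riemann hypothesis for `F/k` — needed only to manufacture the genus datum
through which the vendored Theorem 9.3 is stated) and Theorem 9.3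
(`ellLFunction_eq_prod_of_not_isConstantCurve k W`). This is `isRational_formalL_of_schmidt_leaves`
with its first leaf, F. K. Schmidt's `∂ = 1`, discharged by `minPosDegree_eq_one_holds`
(`FunctionFieldSchmidtDegreeOneProofs`). Relies on: hypotheses `hHW`, `h93` (the two named facts of
the tree still open on this line: Bombieri–Stepanov and Grothendieck–Deligne respectively).
[cite: Ulmer2011ParkCity, Lect. 1, §9, Thm. 9.3 and Exercise 9.2]
[cite: Stichtenoth2009, Cor. 5.1.11 and Thm. 5.2.1] -/
theorem isRational_formalL_of_hasseWeil_of_theorem93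
    (hHW : ∀ (k : Type) [Field k] [Fintype k] [Algebra k[X] F] [Algebra (RatFunc k) F]
      [IsScalarTower k[X] (RatFunc k) F] [FunctionField k F] [Algebra k F] [IsScalarTower k k[X] F],
      DiophantineGeometry.AlgFunctionField.hasseWeil k F)
    (h93 : ∀ (k : Type) [Field k] [Fintype k] [Algebra k[X] F] [Algebra (RatFunc k) F]
      [IsScalarTower k[X] (RatFunc k) F] [FunctionField k F],
      ellLFunction_eq_prod_of_not_isConstantCurve k W) :
    isRational_formalL Fq W :=
  isRational_formalL_of_schmidt_leaves Fq W
    (fun k _ _ _ _ _ _ _ _ _ _ =>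
      DiophantineGeometry.AlgFunctionField.minPosDegree_eq_one_holds k F) hHW h93

end Assembly

/-! ## Assembly after the Hasse–Weil theorem: the fact rests on Theorem 9.3 alone -/

section AssemblyHasseWeil

variable (Fq : Type) [Field Fq] [Fintype Fq] [Algebra Fq[X] F]
  [Algebra (RatFunc Fq) F] [IsScalarTower Fq[X] (RatFunc Fq) F] [FunctionField Fq F]
  (W : WeierstrassCurve F)

/-- **`isRational_formalL` from Ulmer's Theorem 9.3 alone.** With the Hasse–Weil theorem proved in
the tree (`hasseWeil_holds`, Stichtenoth Thm. 5.2.1, `FunctionFieldHasseWeilProofs`) and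
F. K. Schmidt's `∂ = 1` proved (`minPosDegree_eq_one_holds`), the named fact `isRational_formalL Fq W`
follows from the vendored Theorem 9.3 (`ellLFunction_eq_prod_of_not_isConstantCurve k W`, over the
finite constant fields `k` of `F`; only its first clause "`L(E, s)` is a polynomial in `q^{-s}`" is
used, and only at the full constant field when `W` is elliptic and not constant over it), the
constant case being the theorem `isRational_formalL_of_isConstantCurve`. Relies on: hypothesis
`h93` only (named fact, Grothendieck–Deligne; Ulmer, Lecture 4, §1.3).
[cite: Ulmer2011ParkCity, Lect. 1, §9, Thm. 9.3 and Exercise 9.2]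
[cite: Stichtenoth2009, Thm. 5.2.1] -/
theorem isRational_formalL_of_theorem93
    (h93 : ∀ (k : Type) [Field k] [Fintype k] [Algebra k[X] F] [Algebra (RatFunc k) F]
      [IsScalarTower k[X] (RatFunc k) F] [FunctionField k F],
      ellLFunction_eq_prod_of_not_isConstantCurve k W) :
    isRational_formalL Fq W :=
  isRational_formalL_of_hasseWeil_of_theorem93 Fq W
    (fun _ _ _ _ _ _ _ _ _ => DiophantineGeometry.AlgFunctionField.hasseWeil_holds) h93

/-- **`isRational_formalL` from Theorem 9.3 at one full constant field.** If `k` is a finite full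
constant field of `F` (with a compatible global-function-field structure), the single instance
`ellLFunction_eq_prod_of_not_isConstantCurve k W` of Theorem 9.3 gives `isRational_formalL Fq W`:
the genus datum `IsGenus k F (genus k F)` through which the vendored statement is consumable is now
a theorem (`isGenus_genus_holds`, Weil 1948, from F. K. Schmidt and Hasse–Weil). Relies on:
hypothesis `h93` only. [cite: Ulmer2011ParkCity, Lect. 1, §9, Thm. 9.3 and Exercise 9.2]
[cite: Weil1948] -/
theorem isRational_formalL_of_isFullConstantField_of_theorem93 (k : Type) [Field k] [Fintype k]
    [Algebra k[X] F] [Algebra (RatFunc k) F] [IsScalarTower k[X] (RatFunc k) F] [FunctionField k F]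
    (hk : IsFullConstantField k F) (h93 : ellLFunction_eq_prod_of_not_isConstantCurve k W) :
    isRational_formalL Fq W := by
  letI : Algebra k F := ((algebraMap k[X] F).comp Polynomial.C).toAlgebra
  haveI : IsScalarTower k k[X] F := IsScalarTower.of_algebraMap_eq fun c => by
    rw [RingHom.algebraMap_toAlgebra, RingHom.comp_apply, Polynomial.C_eq_algebraMap]
  haveI := isAlgFunctionField_of_functionField k F
  haveI : IsIntegrallyClosedIn k F := (isFullConstantField_iff_isIntegrallyClosedIn k F).mp hk
  have hg := DiophantineGeometry.AlgFunctionField.isGenus_genus_holds (Fq := k) (F := F)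
  intro hE
  exact isRational_formalL_of_isGenus_of_theorem93 Fq W k hk hg h93

omit [Algebra Fq[X] F] [IsScalarTower Fq[X] (RatFunc Fq) F] in
/-- **What Theorem 9.3 must deliver, exactly.** At a finite full constant field `k` of `F` over
which the elliptic curve `W` is *not* constant, the named fact `isRational_formalL Fq W` is
equivalent to its own conclusion read verbatim — there is no constant case left to discharge — and
it is implied by the bare polynomiality `∃ P : ℤ[T], formalL Fq W = P` (take `Q = 1`), the first
clause of Theorem 9.3 for the formal series of (9.1). Relies on: nothing (both directions proved).
[cite: Ulmer2011ParkCity, Lect. 1, §9, (9.1) and Thm. 9.3] -/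
theorem isRational_formalL_of_formalL_eq_polynomial [W.IsElliptic] {P : ℤ[X]}
    (hP : formalL Fq W = P) : isRational_formalL Fq W := by
  intro _
  refine ⟨P, 1, by simp, fun z hz => ?_, by rw [Polynomial.coe_one, one_mul, hP]⟩
  simp at hz

end AssemblyHasseWeil

end Literature.NumberTheory.EllipticCurves.FunctionField

end
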